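import Mathlib
import HarnessLib
import Summits.HubbardSuperconductivity.HubbardSuperconductivity.Theorems.KLProgrammeThermalGreenMatsubaraWordMoments

/-!
# The all-`U` Matsubara (`M → ∞`) limit of a GENERAL external pair-word, with a bound UNIFORM in the external times
# (seat hubbard-kl-k3c4-p2, g3; technique «Matsubara all-U route (R-a), t2 machine»; file 2 of 3)

Continuation of `…ThermalGreenMatsubaraWordMoments` (the word `W_M(s) = ∏_{l<m} ψ⁺_{(y⃗_{Pe l},s_{Pe l})(Pe l).2} ψ⁻_{(y⃗_{Qe l},s_{Qe l})(Qe l).2}`,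
its Wick determinant and termwise limit).  Here t2's domination is run for the general word; the point is that ALL constants are
independent of the external times `s ∈ [0,β]^k` (they come from the remainder kernel of the Matsubara truncation only):

* §1 **`norm_gaussExpect_word_pow_le_allU`** — for every `r > 0`, all `M, n`, all `s ∈ [0,β]^k`:
  `‖∫dμ_{C_M} W_M(s) Vⁿ‖ ≤ n!·(4^m 4^k (1+kK₀)^k e^{βr} exp((βK₀+nε_M) r e^{βK₀r}))·(64(1+K₀)^k(1+kK₀)|U|L²/r)ⁿ`, `ε_M → 0`;
* §2 `word_geometric_domination_allU` (`(n!)⁻¹‖…‖ ≤ D(3/4)ⁿ` beyond an `s`-independent threshold), **`tendsto_gaussExpect_word_mul_grassmannExp_allU`**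
  (EVERY real `U`, `s ∈ [0,β)^k`: `∫dμ_{C_M} W_M(s) e^{−V} → Σ'_n ((−1)ⁿ/n!) Uⁿ Σ_{x⃗}∫ det[vertexLimitEntry]`), and
  **`exists_uniform_bound_gaussExpect_word_allU`** (`∃ C M₀, ∀ M ≥ M₀, ∀ s ∈ [0,β]^k, ‖∫dμ_{C_M} W_M(s) e^{−V}‖ ≤ C`).

File 3 (`…MatsubaraWordL1`) turns pointwise convergence + the uniform bound into `L¹(du)` convergence along a time curve — the
frequency-uniform control of Fourier–Matsubara coefficients of composite correlations needed by `stub_vl_bound`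
(stmt-HubbardSuperconductivity-19858).  Everything is proved; no definition; no smallness.
-/

namespace Summit.HubbardSuperconductivity.HubbardSuperconductivity.Theorems.MatsubaraAllU

set_option linter.dupNamespace false -- summit = problem name (single-conjunct summit), D-0017

open MeasureTheory Finset Filter Topology Literature.MathematicalPhysics.QuantumLattice
  Literature.Probability.LatticeModels
open Literature.MathematicalPhysics.QuantumLattice.GrassmannAlgebra
open scoped Nat ComplexOrder

noncomputable section

variable {L : ℕ} [NeZero L]

/-! ### §1 Domination for every coupling, constants independent of the external times -/

/-- **Domination of the word moments for EVERY coupling, uniformly in the external times `s ∈ [0,β]^k`** (t2's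
`norm_gaussExpect_twoPoint_pow_le_allU`, general word): there are `K₀ ≥ 0` and `ε_M ≥ 0`, `ε_M → 0` (the remainder kernel of
the Matsubara truncation, independent of the word) such that for all `M, n`, every `r > 0` and every `s ∈ [0,β]^k`,
`‖∫dμ_{C_M} W_M(s) Vⁿ‖ ≤ n!·(4^m 4^k (1+kK₀)^k e^{βr} exp((βK₀+nε_M) r e^{βK₀r}))·(64(1+K₀)^k(1+kK₀)|U|L²/r)ⁿ`. -/
theorem norm_gaussExpect_word_pow_le_allU {β : ℝ} (hβ : 0 < β) (μ U : ℝ) {k m : ℕ} (xe : Fin k → TorusSite 2 L)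
    (Pe Qe : Fin m → Fin k × Fin 2) (hPe : Function.Injective Pe) (hQe : Function.Injective Qe) :
    ∃ (K₀ : ℝ) (ε : ℕ → ℝ), 0 ≤ K₀ ∧ (∀ M, 0 ≤ ε M) ∧ Tendsto ε atTop (𝓝 0) ∧
      ∀ (M n : ℕ) (r : ℝ), 0 < r → ∀ se : Fin k → ℝ, (∀ p, se p ∈ Set.Icc (0 : ℝ) β) →
        ‖gaussExpect ℂ (hubbardCovariance L M β μ 0)
            ((List.ofFn fun l : Fin m => positionField L M β 0 (Pe l).2 (xe (Pe l).1) (se (Pe l).1) *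
                positionField L M β 1 (Qe l).2 (xe (Qe l).1) (se (Qe l).1)).prod * hubbardInteraction L M β U ^ n)‖ ≤
          (n ! : ℝ) * ((4 : ℝ) ^ m * 4 ^ k * (1 + k * K₀) ^ k * Real.exp (β * r) *
              Real.exp ((β * K₀ + n * ε M) * r * Real.exp (β * K₀ * r))) *
            (64 * (1 + K₀) ^ k * (1 + k * K₀) * |U| * (L : ℝ) ^ 2 / r) ^ n := by
  classical
  obtain ⟨K₀, wr, hK₀, hwm, hw0, hwK, hwI, hshift, hlim, hkey⟩ := exists_remainderKernel L hβ μ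
  refine ⟨K₀, fun M => ∫ u, wr M u, hK₀, fun M => integral_nonneg fun u => hw0 M u, hlim, ?_⟩
  intro M n r hr se hse
  have hcard : ((Fintype.card (Fin n → TorusSite 2 L) : ℕ) : ℝ) = ((L : ℝ) ^ 2) ^ n := by
    rw [Fintype.card_fun, Fintype.card_fin, Nat.cast_pow, Fintype.card_pi, prod_const, ZMod.card, card_univ,
      Fintype.card_fin, Nat.cast_pow]
  -- the appended enumerations and their fibres
  set P' : Fin (m + n * 2) → Fin (n + k) × Fin 2 := Fin.append (fun l : Fin m => ((Fin.natAdd n (Pe l).1 : Fin (n + k)), (Pe l).2))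
    (fun i : Fin (n * 2) => ((Fin.castAdd k (finProdFinEquiv.symm i : Fin n × Fin 2).1 : Fin (n + k)),
      (finProdFinEquiv.symm i : Fin n × Fin 2).2)) with hP'
  set Q' : Fin (m + n * 2) → Fin (n + k) × Fin 2 := Fin.append (fun l : Fin m => ((Fin.natAdd n (Qe l).1 : Fin (n + k)), (Qe l).2))
    (fun j : Fin (n * 2) => ((Fin.castAdd k (finProdFinEquiv.symm j : Fin n × Fin 2).1 : Fin (n + k)),
      (finProdFinEquiv.symm j : Fin n × Fin 2).2)) with hQ'
  have hfibP : ∀ a : Fin (n + k), (univ.filter fun i : Fin (m + n * 2) => (P' i).1 = a).card ≤ 2 :=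
    card_filter_fst_le_two _ (wordEnum_injective Pe hPe)
  have hfibQ : ∀ a : Fin (n + k), (univ.filter fun j : Fin (m + n * 2) => (Q' j).1 = a).card ≤ 2 :=
    card_filter_fst_le_two _ (wordEnum_injective Qe hQe)
  have hI := integral_sum_prod_sum_le (m := n) β hβ.le (wr M) (hwm M) (hw0 M) K₀ (∫ u, wr M u) hK₀
    (integral_nonneg fun u => hw0 M u) (hwK M) (hshift M) r hr
  set Cn : ℝ := (1 + (n + k : ℝ) * K₀) ^ k * (1 + k * K₀) ^ n with hCn
  have hCn0 : 0 ≤ Cn := by positivity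
  have hdet : ∀ xv : Fin n → TorusSite 2 L, ‖∫ τ in Set.Icc (0 : Fin n → ℝ) (fun _ => β),
      (Matrix.of fun i j : Fin (m + n * 2) =>
        -((vertexSubMatrix L M β (Fin.append xv xe) (Fin.append τ se)).transpose * hubbardCovariance L M β μ 0 *
            vertexSubMatrix L M β (Fin.append xv xe) (Fin.append τ se))
          ((P' i, 0) : VertexLeg (n + k)) ((Q' j, 1) : VertexLeg (n + k))).det‖ ≤
      (4 : ℝ) ^ (m + n * 2) * 4 ^ (n + k) * (Cn * ((n ! : ℝ) / r ^ n * Real.exp (β * r) *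
        Real.exp ((β * K₀ + n * ∫ u, wr M u) * r * Real.exp (β * K₀ * r)))) := by
    intro xv
    refine (norm_integral_le_of_norm_le (((integrableOn_sum_prod_sum β (wr M) (hwm M) (hw0 M) K₀ (hwK M)).const_mul
      ((4 : ℝ) ^ (m + n * 2) * 4 ^ (n + k) * Cn))) ?_).trans ?_
    · refine (ae_restrict_iff' measurableSet_Icc).2 (ae_of_all _ fun τ hτ => ?_)
      have hτ' : ∀ a : Fin (n + k), (Fin.append τ se : Fin (n + k) → ℝ) a ∈ Set.Icc (0 : ℝ) β :=
        append_mem_Icc hτ hse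
      refine (norm_det_vertexWick_le_sum_prod hβ μ _ _ hτ' _ _ hfibP hfibQ (wr M) (hw0 M) (hkey M)).trans ?_
      rw [mul_assoc ((4 : ℝ) ^ (m + n * 2) * 4 ^ (n + k)) Cn]
      exact mul_le_mul_of_nonneg_left (sum_prod_sum_append_le_general (wr M) (hw0 M) K₀ (hwK M) τ se) (by positivity)
    · rw [integral_const_mul, mul_assoc]
      exact mul_le_mul_of_nonneg_left (mul_le_mul_of_nonneg_left hI hCn0) (by positivity)
  -- numerology: `4^{m+2n}·4^{n+k} = 4^m 4^k · 64^n`, `Cn ≤ (1+kK₀)^k 2^{kn} (1+kK₀)^n`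
  have h64 : (4 : ℝ) ^ (m + n * 2) * 4 ^ (n + k) = 4 ^ m * 4 ^ k * 64 ^ n := by
    have h : (64 : ℝ) ^ n = (4 ^ 2) ^ n * 4 ^ n := by rw [← mul_pow]; norm_num
    rw [h, pow_add, pow_add, mul_comm n 2, pow_mul]
    ring
  have hCn_le : Cn ≤ (1 + k * K₀) ^ k * ((1 + K₀) ^ k) ^ n * (1 + k * K₀) ^ n := by
    have h1 : 1 + (n + k : ℝ) * K₀ ≤ (1 + k * K₀) * (1 + n * K₀) := by
      have hkn : 0 ≤ (k : ℝ) * K₀ * (n * K₀) := by positivity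
      nlinarith [hK₀, hkn]
    have h2 : 1 + (n : ℝ) * K₀ ≤ (1 + K₀) ^ n := one_add_mul_le_pow (by linarith) n
    have h3 : (1 + (n + k : ℝ) * K₀) ^ k ≤ ((1 + k * K₀) * (1 + K₀) ^ n) ^ k :=
      pow_le_pow_left₀ (by positivity) (h1.trans (mul_le_mul_of_nonneg_left h2 (by positivity))) k
    calc Cn = (1 + (n + k : ℝ) * K₀) ^ k * (1 + k * K₀) ^ n := rfl
      _ ≤ ((1 + k * K₀) * (1 + K₀) ^ n) ^ k * (1 + k * K₀) ^ n := mul_le_mul_of_nonneg_right h3 (by positivity)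
      _ = (1 + k * K₀) ^ k * ((1 + K₀) ^ k) ^ n * (1 + k * K₀) ^ n := by
          rw [mul_pow, ← pow_mul, ← pow_mul, mul_comm n k]
  rw [gaussExpect_word_mul_hubbardInteraction_pow_eq_det hβ, norm_mul, norm_pow, Complex.norm_real, Real.norm_eq_abs]
  set E : ℝ := Real.exp (β * r) * Real.exp ((β * K₀ + n * ∫ u, wr M u) * r * Real.exp (β * K₀ * r)) with hE
  have hE0 : 0 ≤ E := by positivity
  calc |U| ^ n * ‖∑ xv : Fin n → TorusSite 2 L, _‖
      ≤ |U| ^ n * ∑ xv : Fin n → TorusSite 2 L, (4 : ℝ) ^ (m + n * 2) * 4 ^ (n + k) * (Cn * ((n ! : ℝ) / r ^ n *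
          Real.exp (β * r) * Real.exp ((β * K₀ + n * ∫ u, wr M u) * r * Real.exp (β * K₀ * r)))) := by
        gcongr
        exact (norm_sum_le _ _).trans (sum_le_sum fun xv _ => hdet xv)
    _ = |U| ^ n * ((L : ℝ) ^ 2) ^ n * (4 ^ m * 4 ^ k * 64 ^ n) * Cn * ((n ! : ℝ) / r ^ n) * E := by
        rw [sum_const, card_univ, nsmul_eq_mul, hcard, h64, hE]; ring
    _ ≤ |U| ^ n * ((L : ℝ) ^ 2) ^ n * (4 ^ m * 4 ^ k * 64 ^ n) * ((1 + k * K₀) ^ k * ((1 + K₀) ^ k) ^ n * (1 + k * K₀) ^ n) *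
          ((n ! : ℝ) / r ^ n) * E := by
        gcongr
    _ = (n ! : ℝ) * ((4 : ℝ) ^ m * 4 ^ k * (1 + k * K₀) ^ k * Real.exp (β * r) *
              Real.exp ((β * K₀ + n * ∫ u, wr M u) * r * Real.exp (β * K₀ * r))) *
            (64 * (1 + K₀) ^ k * (1 + k * K₀) * |U| * (L : ℝ) ^ 2 / r) ^ n := by
        have hr' : r ^ n ≠ 0 := pow_ne_zero _ hr.ne'
        rw [hE]
        simp only [div_pow, mul_pow]
        field_simp

/-! ### §2 The all-`U` limit of the word and the bound uniform in the external times -/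

/-- **Geometric domination of the exponential series of the word, for EVERY coupling, uniformly in the external times**:
there are `D ≥ 0` and a threshold (an `atTop`-event in `M`, independent of `s`) beyond which
`(n!)⁻¹ ‖∫dμ_{C_M} W_M(s) Vⁿ‖ ≤ D (3/4)ⁿ` for all `n` and all `s ∈ [0,β]^k`. -/
theorem word_geometric_domination_allU {β : ℝ} (hβ : 0 < β) (μ U : ℝ) {k m : ℕ} (xe : Fin k → TorusSite 2 L)
    (Pe Qe : Fin m → Fin k × Fin 2) (hPe : Function.Injective Pe) (hQe : Function.Injective Qe) :
    ∃ D : ℝ, 0 ≤ D ∧ ∀ᶠ M : ℕ in atTop, ∀ se : Fin k → ℝ, (∀ p, se p ∈ Set.Icc (0 : ℝ) β) → ∀ n : ℕ,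
      ‖((-1 : ℂ) ^ n * ((n ! : ℂ))⁻¹) * gaussExpect ℂ (hubbardCovariance L M β μ 0)
          ((List.ofFn fun l : Fin m => positionField L M β 0 (Pe l).2 (xe (Pe l).1) (se (Pe l).1) *
              positionField L M β 1 (Qe l).2 (xe (Qe l).1) (se (Qe l).1)).prod * hubbardInteraction L M β U ^ n)‖ ≤
        D * (3 / 4 : ℝ) ^ n := by
  obtain ⟨K₀, ε, hK₀, hε0, hεlim, hmom⟩ := norm_gaussExpect_word_pow_le_allU (L := L) hβ μ U xe Pe Qe hPe hQe
  set ρ : ℝ := 64 * (1 + K₀) ^ k * (1 + k * K₀) * |U| * (L : ℝ) ^ 2 with hρ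
  have hρ0 : 0 ≤ ρ := by positivity
  set r : ℝ := 2 * ρ + 1 with hr
  have hr0 : 0 < r := by positivity
  have hratio : ρ / r ≤ 1 / 2 := by
    rw [div_le_iff₀ hr0, hr]; linarith
  have hratio0 : 0 ≤ ρ / r := by positivity
  set A : ℝ := r * Real.exp (β * K₀ * r) with hA
  have hA0 : 0 < A := by positivity
  have hev : ∀ᶠ M in atTop, ε M * A ≤ 1 / 4 := by
    have h1 : Tendsto (fun M => ε M * A) atTop (𝓝 (0 * A)) := hεlim.mul_const A
    rw [zero_mul] at h1
    exact (h1.eventually (ge_mem_nhds (by norm_num : (0 : ℝ) < 1 / 4))).mono fun M hM => hM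
  set D : ℝ := (4 : ℝ) ^ m * 4 ^ k * (1 + k * K₀) ^ k * Real.exp (β * r) * Real.exp (β * K₀ * A) with hD
  refine ⟨D, by positivity, ?_⟩
  filter_upwards [hev] with M hM se hse n
  have hεA1 : |ε M * A| ≤ 1 := by
    rw [abs_of_nonneg (mul_nonneg (hε0 M) hA0.le)]; linarith
  have hexp : Real.exp (ε M * A) ≤ 3 / 2 := by
    have h := Real.abs_exp_sub_one_le hεA1
    rw [abs_of_nonneg (mul_nonneg (hε0 M) hA0.le)] at h
    have h' := (abs_le.mp h).2
    linarith
  rw [norm_mul, norm_mul, norm_pow, norm_neg, norm_one, one_pow, one_mul, norm_inv, Complex.norm_natCast]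
  have hfac : (0 : ℝ) < n ! := by exact_mod_cast Nat.factorial_pos n
  have hkey := hmom M n r hr0 se hse
  have hsplit : Real.exp ((β * K₀ + n * ε M) * r * Real.exp (β * K₀ * r)) =
      Real.exp (β * K₀ * A) * Real.exp (ε M * A) ^ n := by
    rw [← Real.exp_nat_mul, ← Real.exp_add, hA]
    ring_nf
  have hρr : 64 * (1 + K₀) ^ k * (1 + k * K₀) * |U| * (L : ℝ) ^ 2 / r = ρ / r := by rw [hρ]
  calc ((n ! : ℝ))⁻¹ * ‖gaussExpect ℂ (hubbardCovariance L M β μ 0)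
        ((List.ofFn fun l : Fin m => positionField L M β 0 (Pe l).2 (xe (Pe l).1) (se (Pe l).1) *
            positionField L M β 1 (Qe l).2 (xe (Qe l).1) (se (Qe l).1)).prod * hubbardInteraction L M β U ^ n)‖
      ≤ ((n ! : ℝ))⁻¹ * ((n ! : ℝ) * ((4 : ℝ) ^ m * 4 ^ k * (1 + k * K₀) ^ k * Real.exp (β * r) *
          Real.exp ((β * K₀ + n * ε M) * r * Real.exp (β * K₀ * r))) * (ρ / r) ^ n) := by
        rw [← hρr]
        gcongr
    _ = D * (Real.exp (ε M * A) * (ρ / r)) ^ n := by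
        rw [hsplit, hD, mul_pow]
        field_simp
    _ ≤ D * (3 / 4 : ℝ) ^ n := by
        gcongr
        calc Real.exp (ε M * A) * (ρ / r) ≤ (3 / 2) * (1 / 2) := mul_le_mul hexp hratio hratio0 (by norm_num)
          _ = 3 / 4 := by norm_num

/-- **The `M → ∞` limit of a general external pair-word for EVERY coupling** (t2's
`tendsto_gaussExpect_twoPoint_mul_grassmannExp_allU` for a general word; external times `s ∈ [0,β)^k`):
`∫dμ_{C_M} W_M(s) e^{−V} ⟶ Σ'_n ((−1)ⁿ/n!) Uⁿ Σ_{x⃗} ∫_{[0,β]ⁿ} det[vertexLimitEntry on the m+2n legs]` — no smallness. -/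
theorem tendsto_gaussExpect_word_mul_grassmannExp_allU {β : ℝ} (hβ : 0 < β) (μ U : ℝ) {k m : ℕ}
    (xe : Fin k → TorusSite 2 L) {se : Fin k → ℝ} (hse : ∀ p, se p ∈ Set.Ico (0 : ℝ) β)
    (Pe Qe : Fin m → Fin k × Fin 2) (hPe : Function.Injective Pe) (hQe : Function.Injective Qe) :
    Tendsto (fun M : ℕ => gaussExpect ℂ (hubbardCovariance L M β μ 0)
        ((List.ofFn fun l : Fin m => positionField L M β 0 (Pe l).2 (xe (Pe l).1) (se (Pe l).1) *
            positionField L M β 1 (Qe l).2 (xe (Qe l).1) (se (Qe l).1)).prod * grassmannExp (-(hubbardInteraction L M β U))))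
      atTop
      (𝓝 (∑' n : ℕ, ((-1 : ℂ) ^ n * ((n ! : ℂ))⁻¹) * ((U : ℂ) ^ n * ∑ x : Fin n → TorusSite 2 L,
        ∫ τ in Set.Icc (0 : Fin n → ℝ) (fun _ => β),
        (Matrix.of fun i j : Fin (m + n * 2) =>
          vertexLimitEntry L β μ
            ((Fin.append x xe : Fin (n + k) → TorusSite 2 L)
              (Fin.append (fun l : Fin m => ((Fin.natAdd n (Pe l).1 : Fin (n + k)), (Pe l).2))
                (fun i : Fin (n * 2) => ((Fin.castAdd k (finProdFinEquiv.symm i : Fin n × Fin 2).1 : Fin (n + k)),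
                  (finProdFinEquiv.symm i : Fin n × Fin 2).2)) i).1)
            ((Fin.append x xe : Fin (n + k) → TorusSite 2 L)
              (Fin.append (fun l : Fin m => ((Fin.natAdd n (Qe l).1 : Fin (n + k)), (Qe l).2))
                (fun j : Fin (n * 2) => ((Fin.castAdd k (finProdFinEquiv.symm j : Fin n × Fin 2).1 : Fin (n + k)),
                  (finProdFinEquiv.symm j : Fin n × Fin 2).2)) j).1)
            (Fin.append (fun l : Fin m => ((Fin.natAdd n (Pe l).1 : Fin (n + k)), (Pe l).2))
              (fun i : Fin (n * 2) => ((Fin.castAdd k (finProdFinEquiv.symm i : Fin n × Fin 2).1 : Fin (n + k)),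
                (finProdFinEquiv.symm i : Fin n × Fin 2).2)) i).2
            (Fin.append (fun l : Fin m => ((Fin.natAdd n (Qe l).1 : Fin (n + k)), (Qe l).2))
              (fun j : Fin (n * 2) => ((Fin.castAdd k (finProdFinEquiv.symm j : Fin n × Fin 2).1 : Fin (n + k)),
                (finProdFinEquiv.symm j : Fin n × Fin 2).2)) j).2
            ((Fin.append τ se : Fin (n + k) → ℝ)
                (Fin.append (fun l : Fin m => ((Fin.natAdd n (Qe l).1 : Fin (n + k)), (Qe l).2))
                  (fun j : Fin (n * 2) => ((Fin.castAdd k (finProdFinEquiv.symm j : Fin n × Fin 2).1 : Fin (n + k)),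
                    (finProdFinEquiv.symm j : Fin n × Fin 2).2)) j).1 -
              (Fin.append τ se : Fin (n + k) → ℝ)
                (Fin.append (fun l : Fin m => ((Fin.natAdd n (Pe l).1 : Fin (n + k)), (Pe l).2))
                  (fun i : Fin (n * 2) => ((Fin.castAdd k (finProdFinEquiv.symm i : Fin n × Fin 2).1 : Fin (n + k)),
                    (finProdFinEquiv.symm i : Fin n × Fin 2).2)) i).1)).det))) := by
  obtain ⟨D, hD0, hdom⟩ := word_geometric_domination_allU (L := L) hβ μ U xe Pe Qe hPe hQe
  have hseI : ∀ p, se p ∈ Set.Icc (0 : ℝ) β := fun p => Set.Ico_subset_Icc_self (hse p)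
  have hZ : ∀ M : ℕ, gaussExpect ℂ (hubbardCovariance L M β μ 0)
      ((List.ofFn fun l : Fin m => positionField L M β 0 (Pe l).2 (xe (Pe l).1) (se (Pe l).1) *
          positionField L M β 1 (Qe l).2 (xe (Qe l).1) (se (Qe l).1)).prod * grassmannExp (-(hubbardInteraction L M β U))) =
      ∑' n : ℕ, ((-1 : ℂ) ^ n * ((n ! : ℂ))⁻¹) * gaussExpect ℂ (hubbardCovariance L M β μ 0)
        ((List.ofFn fun l : Fin m => positionField L M β 0 (Pe l).2 (xe (Pe l).1) (se (Pe l).1) *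
            positionField L M β 1 (Qe l).2 (xe (Qe l).1) (se (Qe l).1)).prod * hubbardInteraction L M β U ^ n) := fun M =>
    gaussExpect_mul_grassmannExp_neg_eq_tsum _ _ (constPart_hubbardInteraction L M β U)
  simp_rw [hZ]
  refine tendsto_tsum_of_dominated_convergence (bound := fun n => D * (3 / 4 : ℝ) ^ n) ?_ (fun n => ?_) ?_
  · exact (summable_geometric_of_lt_one (by norm_num) (by norm_num)).mul_left D
  · exact (tendsto_gaussExpect_word_mul_hubbardInteraction_pow hβ μ U xe hse Pe Qe n).const_mul _
  · filter_upwards [hdom] with M hM n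
    exact hM se hseI n

/-- **A bound UNIFORM in the external times, eventually in `M`, for EVERY coupling**: there are `C` and a threshold `M₀` with
`‖∫dμ_{C_M} W_M(s) e^{−V}‖ ≤ C` for all `M ≥ M₀` and ALL `s ∈ [0,β]^k` (closed cube).  This is what makes dominated convergence in
the external time available (§7). -/
theorem exists_uniform_bound_gaussExpect_word_allU {β : ℝ} (hβ : 0 < β) (μ U : ℝ) {k m : ℕ} (xe : Fin k → TorusSite 2 L)
    (Pe Qe : Fin m → Fin k × Fin 2) (hPe : Function.Injective Pe) (hQe : Function.Injective Qe) :
    ∃ C : ℝ, 0 ≤ C ∧ ∃ M₀ : ℕ, ∀ M, M₀ ≤ M → ∀ se : Fin k → ℝ, (∀ p, se p ∈ Set.Icc (0 : ℝ) β) →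
      ‖gaussExpect ℂ (hubbardCovariance L M β μ 0)
          ((List.ofFn fun l : Fin m => positionField L M β 0 (Pe l).2 (xe (Pe l).1) (se (Pe l).1) *
              positionField L M β 1 (Qe l).2 (xe (Qe l).1) (se (Qe l).1)).prod *
            grassmannExp (-(hubbardInteraction L M β U)))‖ ≤ C := by
  obtain ⟨D, hD0, hdom⟩ := word_geometric_domination_allU (L := L) hβ μ U xe Pe Qe hPe hQe
  obtain ⟨M₀, hM₀⟩ := eventually_atTop.1 hdom
  refine ⟨D * 4, by positivity, M₀, fun M hM se hse => ?_⟩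
  rw [gaussExpect_mul_grassmannExp_neg_eq_tsum _ _ (constPart_hubbardInteraction L M β U)]
  have hgeom : HasSum (fun n : ℕ => D * (3 / 4 : ℝ) ^ n) (D * 4) := by
    have h := (hasSum_geometric_of_lt_one (by norm_num : (0 : ℝ) ≤ 3 / 4) (by norm_num : (3 / 4 : ℝ) < 1)).mul_left D
    have h4 : (1 - (3 / 4 : ℝ))⁻¹ = 4 := by norm_num
    rwa [h4] at h
  have hsum : Summable fun n : ℕ => ‖((-1 : ℂ) ^ n * ((n ! : ℂ))⁻¹) * gaussExpect ℂ (hubbardCovariance L M β μ 0)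
      ((List.ofFn fun l : Fin m => positionField L M β 0 (Pe l).2 (xe (Pe l).1) (se (Pe l).1) *
          positionField L M β 1 (Qe l).2 (xe (Qe l).1) (se (Qe l).1)).prod * hubbardInteraction L M β U ^ n)‖ :=
    Summable.of_nonneg_of_le (fun n => norm_nonneg _) (fun n => hM₀ M hM se hse n) hgeom.summable
  refine (norm_tsum_le_tsum_norm hsum).trans ?_
  rw [← hgeom.tsum_eq]
  exact Summable.tsum_le_tsum (fun n => hM₀ M hM se hse n) hsum hgeom.summable

end

end Summit.HubbardSuperconductivity.HubbardSuperconductivity.Theorems.MatsubaraAllU
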